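/-
Copyright: the b2b-balaban T⁴-continuum CRUX team, row NE7b leaf lineage `t4-ne7b-formalise-leaf-06` (gen 153). Project licence.
-/
import Mathlib.Analysis.Calculus.Taylor
import Mathlib.Analysis.Calculus.IteratedDeriv.Lemmas
import Mathlib.Analysis.Calculus.ContDiff.Basic

/-!
# THE KERNEL LETTERS OF THE INHERITED-HESSIAN POWER COUNTING IN LOCAL, DIAGONAL CURRENCY WITH THE LAGRANGE CONSTANTS: `Φ ∈ Cᴺ(U)`
# on an open `U` containing the segments `[0, p]` only, size letters on the DIAGONAL `DⁿΦ(t•p)[p,…,p]` along the segment only (the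
# currency a lattice-kernel supplier delivers ray by ray), and — for scalar kernels — `|Φ p| ≤ (K₂∕2)‖p‖²`, `|Φ p − ½D²Φ(0)[p,p]| ≤ (K₄∕24)‖p‖⁴`,
# both SHARP (row NE7b, node U5c; the `ContDiffOn` ∕ diagonal ∕ Lagrange companion of `…InheritedHessianPowerCounting` §3–§4)

Cell `pub-balaban`, sub-cell `t4`, spine estimate NE7b (`T4WeightBudget.RelWeightBound`; the cell's OWN estimate — NOT PRINTED in
[Bałaban 1983–89], NOT PROVED).  Crux-route work under `Spine/NE7b/` by a row leaf on the convexity road under FREEZE (0)'s crux-prover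
clause; NOTHING of Bałaban's is named or asserted; no `T4Continuum/Support` leaf typed; no `def`; zero `sorry`.  Imports: Mathlib only —
independent of the farm's olean frontier (`…InheritedHessianPowerCounting` (IHPC, p376809 ✓) and `…LatticeKernelMoments` (LKM, retry lane)
have no hub olean at the time of writing, so nothing of theirs is imported or restated; IHPC §5–§6 consume VALUE letters only, and this
file's §6 ENDs are those letters verbatim in shape).

WHY.  Leaf-01's IHPC types the cancellation mechanism behind the road's by-value debt (i) (the (A3) display ∕ inherited-Hessian split) for
an inherited kernel `Φ` read as a function of MOMENTUM: (W) no constant term, (R) evenness, (S) the marginal part subtracted, (D) a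
fourth-derivative letter ⟹ the inherited sum is bounded UNIFORMLY in `k` (its §5–§6, which take only `‖Φ q‖ ≤ C‖q‖²` ∕ `|R q| ≤ C‖q‖⁴` on
`‖q‖ ≤ ρ`).  Its kernel letters §3–§4 ask GLOBAL `Φ ∈ Cᴺ(E)` and the OPERATOR-NORM letter `‖D⁴Φ q‖ ≤ K₄` on the closed ball, with the
vector-valued mean-value constants (`‖Φ p‖ ≤ K₂‖p‖²`, `‖Φ p − ½D²Φ(0)[p,p]‖ ≤ (K₄∕6)‖p‖⁴`), and its NOT-HERE names «the
`ContDiffOn`-along-rays-inside-the-ball variants» as routine, not typed.  THIS FILE types them and tightens the currency on three counts,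
each at no cost to IHPC's consumers: (1) REGULARITY is asked only where the ray argument uses it — `ContDiffOn ℝ N Φ U` on an open `U`
containing the segment `{t•p : t ∈ [0,1]}` (two-sided at `0`, which evenness needs); (2) the SIZE letter is asked on the DIAGONAL along the
segment, `‖D⁴Φ(t•p)[p,p,p,p]‖ ≤ K₄‖p‖⁴` — the only values the ray `t ↦ Φ(t•p)` ever sees, and exactly the currency in which LKM's supplier
delivers (D) («`|Φ_e⁗(t)| ≤ Σ_x |k x|·⟨x,e⟩⁴`» IS a bound on `D⁴Φ(te)[e,e,e,e]`, ray by ray), so no passage through the operator norm of a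
symmetric 4-linear form (polarisation, up to `4⁴∕4!` in a general normed space) is ever paid; the operator-norm letter implies the diagonal
one in one line (§6), so IHPC's currency is still served; (3) for SCALAR kernels (IHPC §6 is scalar currency) Taylor's theorem with the
LAGRANGE remainder (Mathlib's `taylor_mean_remainder_lagrange_iteratedDeriv`) replaces the vector-valued bound, so the constants are
`K₂∕2` and `K₄∕24` instead of `K₂` and `K₄∕6` — both attained (§7) —; by value the subtracted remainder's constant `C` enters IHPC §6's
floor `(a_min·μ − C·ρ²·L²∕(L²−1))‖p‖²` linearly, so the admissible window radius `ρ²` gains the factor `4`.  WHICH supplier delivers `K₄`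
is not this file's business: for lattice kernels it is LOCALITY (LKM: the fourth directional moment of the position-space kernel); a
field-space Cauchy letter `(M, δ)` sizes a kernel and is a different object (leaf-01 g83 A-1 l.57161) — it is not invoked here.

WHAT IS PROVED ([folklore]: Taylor's theorem at `0` along `[0,1]` with the mean-value ∕ Lagrange remainder; Mathlib's
`taylor_mean_remainder_bound`, `taylor_mean_remainder_lagrange_iteratedDeriv`, `iteratedDeriv_comp_neg`,
`ContinuousLinearMap.iteratedFDerivWithin_comp_right`, `iteratedFDerivWithin_of_isOpen` BY NAME):
* §1 ONE REAL VARIABLE, `G`-valued, regularity AT the points of `[0,1]` only (`∀ t ∈ [0,1], ContDiffAt ℝ N g t`), `g` even, `g 0 = 0`: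
  `norm_le_of_even_of_contDiffAt` (`‖g″‖ ≤ M₂` on `[0,1]` ⊢ `‖g 1‖ ≤ M₂`) and `norm_sub_half_iteratedDeriv_two_le_of_even_of_contDiffAt`
  (`‖g⁗‖ ≤ M₄` on `[0,1]` ⊢ `‖g 1 − ½g″(0)‖ ≤ M₄∕6`) — IHPC §3's statements with the global `Cᴺ` replaced by `Cᴺ` at the points of `[0,1]`.
* §2 ONE REAL VARIABLE, SCALAR, LAGRANGE: `abs_le_half_of_even` (`|g″| ≤ M₂` on the OPEN `(0,1)` ⊢ `|g 1| ≤ M₂∕2`) and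
  **`abs_sub_half_iteratedDeriv_two_le_of_even`** (`|g⁗| ≤ M₄` on `(0,1)` ⊢ `|g 1 − ½g″(0)| ≤ M₄∕24`).
* §3 RAYS UNDER `ContDiffOn`: `contDiffAt_ray_of_contDiffOn`, **`iteratedDeriv_ray_of_contDiffOn`** (`U` open, `Φ ∈ Cᴺ(U)`, `t•p ∈ U`, `n ≤ N` ⊢
  `(s ↦ Φ(s•p))⁽ⁿ⁾(t) = DⁿΦ(t•p)[p,…,p]`), `smul_mem_of_closedBall_subset` (segments of `closedBall 0 ρ ⊆ U` lie in `U`).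
* §4 THE KERNEL LETTERS, `G`-VALUED, LOCAL AND DIAGONAL (IHPC §4's constants): **`norm_le_of_hessian_diag_le`** (`Φ ∈ C²(U)` even, `Φ 0 = 0`,
  `‖D²Φ(t•p)[p,p]‖ ≤ K₂‖p‖²` for `t ∈ [0,1]` ⊢ `‖Φ p‖ ≤ K₂‖p‖²`) and **`norm_sub_half_hessian_le_of_fourth_diag_le`** (`Φ ∈ C⁴(U)`,
  `‖D⁴Φ(t•p)[p,p,p,p]‖ ≤ K₄‖p‖⁴` ⊢ `‖Φ p − ½D²Φ(0)[p,p]‖ ≤ (K₄∕6)‖p‖⁴`).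
* §5 THE KERNEL LETTERS, SCALAR, LOCAL, DIAGONAL AND SHARP: **`abs_le_of_hessian_diag_le`** (`|D²Φ(t•p)[p,p]| ≤ K₂‖p‖²` for `t ∈ (0,1)` ⊢
  `|Φ p| ≤ (K₂∕2)‖p‖²`) and **`abs_sub_half_hessian_le_of_fourth_diag_le`** (`|D⁴Φ(t•p)[p,p,p,p]| ≤ K₄‖p‖⁴` for `t ∈ (0,1)` ⊢
  `|Φ p − ½D²Φ(0)[p,p]| ≤ (K₄∕24)‖p‖⁴`).
* §6 ON THE BALL — THE ENDs in IHPC §5–§6's input shape (`U` open ⊇ `closedBall 0 ρ`, letters `∀ q ∈ closedBall 0 ρ, ∀ v, |DⁿΦ(q)[v,…,v]| ≤ Kₙ‖v‖ⁿ`):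
  **`abs_le_on_closedBall`** (`∀ p, ‖p‖ ≤ ρ → |Φ p| ≤ (K₂∕2)‖p‖²` — the `hΦ` of IHPC §5 `norm_rescaled_le_of_sq` with `C = K₂∕2`),
  **`abs_sub_half_hessian_le_on_closedBall`** (`∀ p, ‖p‖ ≤ ρ → |Φ p − ½D²Φ(0)[p,p]| ≤ (K₄∕24)‖p‖⁴` — the `hR` of IHPC §6
  `floor_uniform_of_running_coefficient` with `R q = Φ q − ½D²Φ(0)[q,q]`, `C = K₄∕24`), `abs_diag_le_of_opNorm_le` and the operator-norm
  corollaries `abs_le_on_closedBall_of_opNorm` ∕ `abs_sub_half_hessian_le_on_closedBall_of_opNorm` (IHPC's own currency `‖DⁿΦ q‖ ≤ Kₙ`, now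
  with `Φ ∈ Cᴺ(U)` only and the Lagrange constants).
* §7 toys (kernel): `t ↦ t⁴` attains `K₄∕24` (`|1 − 0| ≤ 24∕24`), `t ↦ t²` attains `K₂∕2`.

NOT HERE (honest): the junction with IHPC §5–§6 and with LKM BY IMPORT (olean-gated; by name in prose, certificate by source concat);
`G`-valued Lagrange constants (the vector-valued remainder is Mathlib's `1∕n!`; the sharp `1∕(n+1)!` for `G`-valued kernels would go through
the dual and is not typed); WHICH kernels print's inherited terms have, that they ARE even ∕ annihilate constants ∕ are `C⁴` near which ball
with which `K₄` ((A3) ∕ (A1c) readings — NC-NE7b-α UNRULED; LKM reads `K₄` as a fourth moment BY SHAPE); the `β`-flow letter `a_min ≤ a_k`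
(displayed in IHPC §6, discharged nowhere); anything of Bałaban's.  BY-NAME EFFECT ON THE WALL: NONE (suppliers for a displayed letter).
NE7b NOT PRINTED ∕ NOT PROVED; spine PROVED 0∕9; rung (B)+1 on a FINITE torus — NOT infinite volume, NOT the mass gap, NOT Clay.  HONEST
DEPENDENCY: continuum YM on T⁴ ⇐ BetaPertH ∧ nine spine estimates (0∕9 proved); BetaPertH ⇐ (D1) ∧ (D4) ∧ CAP+tail; G-an2-4 gates asym,
D1 and NE2∕3∕4.
-/

set_option autoImplicit false

noncomputable section

open Set Filter Topology

namespace Summit.QuantumFields.BalabanUV.T4Continuum.NE7b.InheritedHessianPowerCountingLocal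

variable {E : Type*} [NormedAddCommGroup E] [NormedSpace ℝ E]
variable {G : Type*} [NormedAddCommGroup G] [NormedSpace ℝ G]

/-! ## §1 One real variable, `G`-valued: Taylor at `0` along `[0,1]` with regularity at the points of `[0,1]` only -/

/-- **THE MARGINAL RAY LETTER, LOCAL REGULARITY** [folklore]: `g : ℝ → G` with `ContDiffAt ℝ 2 g t` at every `t ∈ [0,1]` (two-sided
at `0`), even, `g 0 = 0`, `‖g″‖ ≤ M₂` on `[0,1]` ⟹ `‖g 1‖ ≤ M₂` (the constant term vanishes by hypothesis, the linear term by evenness;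
Mathlib's vector-valued remainder bound, constant `1∕1!`). -/
theorem norm_le_of_even_of_contDiffAt {g : ℝ → G} {M₂ : ℝ} (hg : ∀ t ∈ Icc (0 : ℝ) 1, ContDiffAt ℝ 2 g t)
    (heven : ∀ t, g (-t) = g t) (h0 : g 0 = 0) (hM : ∀ t ∈ Icc (0 : ℝ) 1, ‖iteratedDeriv 2 g t‖ ≤ M₂) : ‖g 1‖ ≤ M₂ := by
  have hU : UniqueDiffOn ℝ (Icc (0 : ℝ) 1) := uniqueDiffOn_Icc zero_lt_one
  have hf : ContDiffOn ℝ (1 + 1) g (Icc 0 1) := fun t ht => by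
    norm_num; exact (hg t ht).contDiffWithinAt
  have hw : ∀ {n : ℕ}, n ≤ 2 → ∀ t ∈ Icc (0 : ℝ) 1, iteratedDerivWithin n g (Icc 0 1) t = iteratedDeriv n g t :=
    fun hn t ht => iteratedDerivWithin_eq_iteratedDeriv hU ((hg t ht).of_le (by exact_mod_cast hn)) ht
  have hC : ∀ y ∈ Icc (0 : ℝ) 1, ‖iteratedDerivWithin (1 + 1) g (Icc 0 1) y‖ ≤ M₂ := fun y hy => by
    rw [hw le_rfl y hy]; exact hM y hy
  have hT := taylor_mean_remainder_bound (f := g) (n := 1) (x := 1) zero_le_one hf (right_mem_Icc.2 zero_le_one) hC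
  -- the odd derivative vanishes at `0` by evenness (halving by hand: no `NoZeroSMulDivisors` instance assumed)
  have hD1 : iteratedDeriv 1 g 0 = 0 := by
    have h := iteratedDeriv_comp_neg 1 g 0
    rw [show (fun x => g (-x)) = g from funext heven, neg_zero, pow_one, neg_one_smul] at h
    have h2 : iteratedDeriv 1 g 0 + iteratedDeriv 1 g 0 = 0 := by nth_rewrite 2 [h]; exact add_neg_cancel _
    calc iteratedDeriv 1 g 0 = (2 : ℝ)⁻¹ • ((2 : ℝ) • iteratedDeriv 1 g 0) := by
          rw [smul_smul, inv_mul_cancel₀ two_ne_zero, one_smul]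
      _ = 0 := by rw [two_smul, h2, smul_zero]
  have hev : taylorWithinEval g 1 (Icc 0 1) 0 1 = 0 := by
    simp [taylorWithinEval_succ, taylor_within_zero_eval, hw one_le_two 0 (left_mem_Icc.2 zero_le_one), hD1, h0]
  rw [hev, sub_zero] at hT
  simpa using hT

/-- **THE SUBTRACTED RAY LETTER, LOCAL REGULARITY** [folklore]: `ContDiffAt ℝ 4 g t` at every `t ∈ [0,1]`, `g` even, `g 0 = 0`,
`‖g⁗‖ ≤ M₄` on `[0,1]` ⟹ `‖g 1 − ½·g″(0)‖ ≤ M₄∕6` (Mathlib's vector-valued remainder constant `1∕3!`). -/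
theorem norm_sub_half_iteratedDeriv_two_le_of_even_of_contDiffAt {g : ℝ → G} {M₄ : ℝ}
    (hg : ∀ t ∈ Icc (0 : ℝ) 1, ContDiffAt ℝ 4 g t) (heven : ∀ t, g (-t) = g t) (h0 : g 0 = 0)
    (hM : ∀ t ∈ Icc (0 : ℝ) 1, ‖iteratedDeriv 4 g t‖ ≤ M₄) :
    ‖g 1 - (1 / 2 : ℝ) • iteratedDeriv 2 g 0‖ ≤ M₄ / 6 := by
  have hU : UniqueDiffOn ℝ (Icc (0 : ℝ) 1) := uniqueDiffOn_Icc zero_lt_one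
  have hf : ContDiffOn ℝ (3 + 1) g (Icc 0 1) := fun t ht => by
    norm_num; exact (hg t ht).contDiffWithinAt
  have hw : ∀ {n : ℕ}, n ≤ 4 → ∀ t ∈ Icc (0 : ℝ) 1, iteratedDerivWithin n g (Icc 0 1) t = iteratedDeriv n g t :=
    fun hn t ht => iteratedDerivWithin_eq_iteratedDeriv hU ((hg t ht).of_le (by exact_mod_cast hn)) ht
  have hC : ∀ y ∈ Icc (0 : ℝ) 1, ‖iteratedDerivWithin (3 + 1) g (Icc 0 1) y‖ ≤ M₄ := fun y hy => by
    rw [hw le_rfl y hy]; exact hM y hy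
  have hT := taylor_mean_remainder_bound (f := g) (n := 3) (x := 1) zero_le_one hf (right_mem_Icc.2 zero_le_one) hC
  have hodd : ∀ {n : ℕ}, Odd n → iteratedDeriv n g 0 = 0 := by
    intro n hn
    have h := iteratedDeriv_comp_neg n g 0
    rw [show (fun x => g (-x)) = g from funext heven, neg_zero, hn.neg_one_pow, neg_one_smul] at h
    have h2 : iteratedDeriv n g 0 + iteratedDeriv n g 0 = 0 := by nth_rewrite 2 [h]; exact add_neg_cancel _
    calc iteratedDeriv n g 0 = (2 : ℝ)⁻¹ • ((2 : ℝ) • iteratedDeriv n g 0) := by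
          rw [smul_smul, inv_mul_cancel₀ two_ne_zero, one_smul]
      _ = 0 := by rw [two_smul, h2, smul_zero]
  have h0m : (0 : ℝ) ∈ Icc (0 : ℝ) 1 := left_mem_Icc.2 zero_le_one
  have hev : taylorWithinEval g 3 (Icc 0 1) 0 1 = (1 / 2 : ℝ) • iteratedDeriv 2 g 0 := by
    simp [taylorWithinEval_succ, taylor_within_zero_eval, hw (show 1 ≤ 4 by norm_num) 0 h0m,
      hw (show 2 ≤ 4 by norm_num) 0 h0m, hw (show 3 ≤ 4 by norm_num) 0 h0m, hodd odd_one,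
      hodd (show Odd 3 by decide), h0]
    norm_num
  rw [hev] at hT
  simpa [Nat.factorial] using hT

/-! ## §2 One real variable, scalar: the LAGRANGE constants, letters on the open interval -/

/-- **THE MARGINAL RAY LETTER, SHARP** [folklore]: `g : ℝ → ℝ` with `ContDiffAt ℝ 2 g t` at every `t ∈ [0,1]`, even, `g 0 = 0`,
`|g″| ≤ M₂` on the OPEN interval `(0,1)` ⟹ `|g 1| ≤ M₂∕2` (Lagrange: `g 1 = g 0 + g′(0) + ½g″(ξ)`). -/
theorem abs_le_half_of_even {g : ℝ → ℝ} {M₂ : ℝ} (hg : ∀ t ∈ Icc (0 : ℝ) 1, ContDiffAt ℝ 2 g t)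
    (heven : ∀ t, g (-t) = g t) (h0 : g 0 = 0) (hM : ∀ t ∈ Ioo (0 : ℝ) 1, |iteratedDeriv 2 g t| ≤ M₂) :
    |g 1| ≤ M₂ / 2 := by
  have hU : UniqueDiffOn ℝ (Icc (0 : ℝ) 1) := uniqueDiffOn_Icc zero_lt_one
  have hf : ContDiffOn ℝ (1 + 1) g (uIcc 0 1) := by
    rw [uIcc_of_le zero_le_one]; exact fun t ht => by norm_num; exact (hg t ht).contDiffWithinAt
  obtain ⟨ξ, hξ, hL⟩ := taylor_mean_remainder_lagrange_iteratedDeriv (f := g) (n := 1) (x₀ := 0) (x := 1) zero_ne_one hf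
  rw [uIoo_of_le zero_le_one] at hξ
  rw [uIcc_of_le zero_le_one] at hL
  have hD1 : iteratedDeriv 1 g 0 = 0 := by
    have h := iteratedDeriv_comp_neg 1 g 0
    rw [show (fun x => g (-x)) = g from funext heven, neg_zero, pow_one, neg_one_smul] at h
    linarith
  have hw1 : iteratedDerivWithin 1 g (Icc 0 1) 0 = iteratedDeriv 1 g 0 :=
    iteratedDerivWithin_eq_iteratedDeriv hU ((hg 0 (left_mem_Icc.2 zero_le_one)).of_le (by norm_num))
      (left_mem_Icc.2 zero_le_one)
  have hev : taylorWithinEval g 1 (Icc 0 1) 0 1 = 0 := by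
    simp [taylorWithinEval_succ, taylor_within_zero_eval, hw1, hD1, h0]
  rw [hev, sub_zero] at hL
  have key : iteratedDeriv (1 + 1) g ξ * (1 - 0) ^ (1 + 1) / ((1 + 1).factorial : ℝ) = iteratedDeriv 2 g ξ / 2 := by
    norm_num [Nat.factorial]
  rw [hL, key, abs_div, abs_two]
  exact div_le_div_of_nonneg_right (hM ξ hξ) zero_le_two

/-- **THE SUBTRACTED RAY LETTER, SHARP** [folklore]: `ContDiffAt ℝ 4 g t` at every `t ∈ [0,1]`, `g` even, `g 0 = 0`, `|g⁗| ≤ M₄` on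
`(0,1)` ⟹ `|g 1 − ½·g″(0)| ≤ M₄∕24` (Lagrange: the constant and odd terms vanish, the quadratic term is what is subtracted, and the
remainder is `g⁗(ξ)∕4!`). -/
theorem abs_sub_half_iteratedDeriv_two_le_of_even {g : ℝ → ℝ} {M₄ : ℝ} (hg : ∀ t ∈ Icc (0 : ℝ) 1, ContDiffAt ℝ 4 g t)
    (heven : ∀ t, g (-t) = g t) (h0 : g 0 = 0) (hM : ∀ t ∈ Ioo (0 : ℝ) 1, |iteratedDeriv 4 g t| ≤ M₄) :
    |g 1 - iteratedDeriv 2 g 0 / 2| ≤ M₄ / 24 := by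
  have hU : UniqueDiffOn ℝ (Icc (0 : ℝ) 1) := uniqueDiffOn_Icc zero_lt_one
  have hf : ContDiffOn ℝ (3 + 1) g (uIcc 0 1) := by
    rw [uIcc_of_le zero_le_one]; exact fun t ht => by norm_num; exact (hg t ht).contDiffWithinAt
  obtain ⟨ξ, hξ, hL⟩ := taylor_mean_remainder_lagrange_iteratedDeriv (f := g) (n := 3) (x₀ := 0) (x := 1) zero_ne_one hf
  rw [uIoo_of_le zero_le_one] at hξ
  rw [uIcc_of_le zero_le_one] at hL
  have hodd : ∀ {n : ℕ}, Odd n → iteratedDeriv n g 0 = 0 := by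
    intro n hn
    have h := iteratedDeriv_comp_neg n g 0
    rw [show (fun x => g (-x)) = g from funext heven, neg_zero, hn.neg_one_pow, neg_one_smul] at h
    linarith
  have h0m : (0 : ℝ) ∈ Icc (0 : ℝ) 1 := left_mem_Icc.2 zero_le_one
  have hw : ∀ {n : ℕ}, n ≤ 4 → iteratedDerivWithin n g (Icc 0 1) 0 = iteratedDeriv n g 0 :=
    fun hn => iteratedDerivWithin_eq_iteratedDeriv hU ((hg 0 h0m).of_le (by exact_mod_cast hn)) h0m
  have hev : taylorWithinEval g 3 (Icc 0 1) 0 1 = iteratedDeriv 2 g 0 / 2 := by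
    simp [taylorWithinEval_succ, taylor_within_zero_eval, hw (show 1 ≤ 4 by norm_num), hw (show 2 ≤ 4 by norm_num),
      hw (show 3 ≤ 4 by norm_num), hodd odd_one, hodd (show Odd 3 by decide), h0]
    ring
  rw [hev] at hL
  have key : iteratedDeriv (3 + 1) g ξ * (1 - 0) ^ (3 + 1) / ((3 + 1).factorial : ℝ) = iteratedDeriv 4 g ξ / 24 := by
    norm_num [Nat.factorial]
  rw [hL, key, abs_div, abs_of_pos (show (0 : ℝ) < 24 by norm_num)]
  exact div_le_div_of_nonneg_right (hM ξ hξ) (by norm_num)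

/-! ## §3 Rays under `ContDiffOn` on an open set -/

/-- The ray `s ↦ Φ(s•p)` of `Φ ∈ Cᴺ(U)` (`U` open) is `Cᴺ` at every `t` with `t•p ∈ U`. -/
theorem contDiffAt_ray_of_contDiffOn {Φ : E → G} {U : Set E} (hU : IsOpen U) {N : ℕ} (hΦ : ContDiffOn ℝ N Φ U) (p : E)
    {t : ℝ} (ht : t • p ∈ U) : ContDiffAt ℝ N (fun s : ℝ => Φ (s • p)) t :=
  (hΦ.contDiffAt (hU.mem_nhds ht)).comp t (contDiff_id.smul contDiff_const).contDiffAt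

/-- **THE RAY IS THE KERNEL ALONG A LINE, LOCALLY** [folklore]: for `Φ ∈ Cᴺ(U)`, `U` open, `t•p ∈ U` and `n ≤ N`, the `n`-th
derivative of `s ↦ Φ(s•p)` at `t` is the diagonal `DⁿΦ(t•p)[p,…,p]` (Mathlib's `ContinuousLinearMap.iteratedFDerivWithin_comp_right`
on the open preimage of `U` under the line `toSpanSingleton ℝ p`, then `…Within = …` on open sets). -/
theorem iteratedDeriv_ray_of_contDiffOn {Φ : E → G} {U : Set E} (hU : IsOpen U) {N n : ℕ} (hΦ : ContDiffOn ℝ N Φ U)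
    (hn : n ≤ N) (p : E) {t : ℝ} (ht : t • p ∈ U) :
    iteratedDeriv n (fun s : ℝ => Φ (s • p)) t = iteratedFDeriv ℝ n Φ (t • p) fun _ => p := by
  set g : ℝ →L[ℝ] E := ContinuousLinearMap.toSpanSingleton ℝ p with hg
  have hgt : g t = t • p := by simp [hg]
  have hV : IsOpen (g ⁻¹' U) := hU.preimage g.continuous
  have htV : t ∈ g ⁻¹' U := by rw [mem_preimage, hgt]; exact ht
  have hfun : (fun s : ℝ => Φ (s • p)) = Φ ∘ ⇑g := by funext s; simp [hg]
  rw [hfun, ← iteratedDerivWithin_of_isOpen hV htV, iteratedDerivWithin_eq_iteratedFDerivWithin,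
    g.iteratedFDerivWithin_comp_right hΦ hU.uniqueDiffOn hV.uniqueDiffOn htV (by exact_mod_cast hn),
    ContinuousMultilinearMap.compContinuousLinearMap_apply, iteratedFDerivWithin_of_isOpen n hU (by rw [hgt]; exact ht), hgt]
  congr 1
  funext i
  simp [hg]

/-- Segments of the closed ball: `closedBall 0 ρ ⊆ U`, `‖p‖ ≤ ρ`, `t ∈ [0,1]` ⟹ `t•p ∈ U`. -/
theorem smul_mem_of_closedBall_subset {U : Set E} {ρ : ℝ} (hU : Metric.closedBall (0 : E) ρ ⊆ U) {p : E} (hp : ‖p‖ ≤ ρ)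
    {t : ℝ} (ht : t ∈ Icc (0 : ℝ) 1) : t • p ∈ U := by
  refine hU (mem_closedBall_zero_iff.2 ?_)
  rw [norm_smul, Real.norm_eq_abs, abs_of_nonneg ht.1]
  calc t * ‖p‖ ≤ 1 * ‖p‖ := by gcongr; exact ht.2
    _ ≤ ρ := by rw [one_mul]; exact hp

/-! ## §4 The kernel letters, `G`-valued: local regularity, diagonal letters along the segment (IHPC §4's constants) -/

/-- **THE MARGINAL KERNEL LETTER, LOCAL AND DIAGONAL** [folklore]: `U` open, `Φ ∈ C²(U)` even with `Φ 0 = 0`, the segment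
`{t•p : t ∈ [0,1]} ⊆ U` and the DIAGONAL letter `‖D²Φ(t•p)[p,p]‖ ≤ K₂‖p‖²` along it ⟹ `‖Φ p‖ ≤ K₂‖p‖²`. -/
theorem norm_le_of_hessian_diag_le {Φ : E → G} {U : Set E} (hU : IsOpen U) (hΦ : ContDiffOn ℝ 2 Φ U)
    (heven : ∀ q, Φ (-q) = Φ q) (h0 : Φ 0 = 0) {p : E} (hseg : ∀ t ∈ Icc (0 : ℝ) 1, t • p ∈ U) {K₂ : ℝ}
    (hK : ∀ t ∈ Icc (0 : ℝ) 1, ‖iteratedFDeriv ℝ 2 Φ (t • p) fun _ => p‖ ≤ K₂ * ‖p‖ ^ 2) :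
    ‖Φ p‖ ≤ K₂ * ‖p‖ ^ 2 := by
  have h := norm_le_of_even_of_contDiffAt (g := fun s : ℝ => Φ (s • p)) (M₂ := K₂ * ‖p‖ ^ 2)
    (fun t ht => contDiffAt_ray_of_contDiffOn hU hΦ p (hseg t ht)) (fun t => by simp [neg_smul, heven])
    (by simpa using h0) fun t ht => by
      rw [iteratedDeriv_ray_of_contDiffOn hU hΦ le_rfl p (hseg t ht)]; exact hK t ht
  simpa using h

/-- **THE SUBTRACTED KERNEL LETTER, LOCAL AND DIAGONAL** [folklore]: `U` open, `Φ ∈ C⁴(U)` even with `Φ 0 = 0`, the segment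
`{t•p : t ∈ [0,1]} ⊆ U` and the DIAGONAL letter `‖D⁴Φ(t•p)[p,p,p,p]‖ ≤ K₄‖p‖⁴` along it ⟹ `‖Φ p − ½·D²Φ(0)[p,p]‖ ≤ (K₄∕6)‖p‖⁴`. -/
theorem norm_sub_half_hessian_le_of_fourth_diag_le {Φ : E → G} {U : Set E} (hU : IsOpen U) (hΦ : ContDiffOn ℝ 4 Φ U)
    (heven : ∀ q, Φ (-q) = Φ q) (h0 : Φ 0 = 0) {p : E} (hseg : ∀ t ∈ Icc (0 : ℝ) 1, t • p ∈ U) {K₄ : ℝ}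
    (hK : ∀ t ∈ Icc (0 : ℝ) 1, ‖iteratedFDeriv ℝ 4 Φ (t • p) fun _ => p‖ ≤ K₄ * ‖p‖ ^ 4) :
    ‖Φ p - (1 / 2 : ℝ) • iteratedFDeriv ℝ 2 Φ 0 (fun _ => p)‖ ≤ K₄ / 6 * ‖p‖ ^ 4 := by
  have h0U : (0 : ℝ) • p ∈ U := hseg 0 (left_mem_Icc.2 zero_le_one)
  have h := norm_sub_half_iteratedDeriv_two_le_of_even_of_contDiffAt (g := fun s : ℝ => Φ (s • p)) (M₄ := K₄ * ‖p‖ ^ 4)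
    (fun t ht => contDiffAt_ray_of_contDiffOn hU hΦ p (hseg t ht)) (fun t => by simp [neg_smul, heven])
    (by simpa using h0) fun t ht => by
      rw [iteratedDeriv_ray_of_contDiffOn hU hΦ le_rfl p (hseg t ht)]; exact hK t ht
  rw [iteratedDeriv_ray_of_contDiffOn hU hΦ (by norm_num) p h0U, zero_smul, one_smul] at h
  calc _ ≤ K₄ * ‖p‖ ^ 4 / 6 := h
    _ = K₄ / 6 * ‖p‖ ^ 4 := by ring

/-! ## §5 The kernel letters, scalar: local, diagonal along the open segment, Lagrange constants -/

/-- **THE MARGINAL KERNEL LETTER, SHARP** [folklore]: `U` open, `Φ : E → ℝ`, `Φ ∈ C²(U)` even with `Φ 0 = 0`, the segment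
`{t•p : t ∈ [0,1]} ⊆ U` and `|D²Φ(t•p)[p,p]| ≤ K₂‖p‖²` for `t ∈ (0,1)` ⟹ `|Φ p| ≤ (K₂∕2)‖p‖²`. -/
theorem abs_le_of_hessian_diag_le {Φ : E → ℝ} {U : Set E} (hU : IsOpen U) (hΦ : ContDiffOn ℝ 2 Φ U)
    (heven : ∀ q, Φ (-q) = Φ q) (h0 : Φ 0 = 0) {p : E} (hseg : ∀ t ∈ Icc (0 : ℝ) 1, t • p ∈ U) {K₂ : ℝ}
    (hK : ∀ t ∈ Ioo (0 : ℝ) 1, |iteratedFDeriv ℝ 2 Φ (t • p) fun _ => p| ≤ K₂ * ‖p‖ ^ 2) :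
    |Φ p| ≤ K₂ / 2 * ‖p‖ ^ 2 := by
  have h := abs_le_half_of_even (g := fun s : ℝ => Φ (s • p)) (M₂ := K₂ * ‖p‖ ^ 2)
    (fun t ht => contDiffAt_ray_of_contDiffOn hU hΦ p (hseg t ht)) (fun t => by simp [neg_smul, heven])
    (by simpa using h0) fun t ht => by
      rw [iteratedDeriv_ray_of_contDiffOn hU hΦ le_rfl p (hseg t (Ioo_subset_Icc_self ht))]; exact hK t ht
  calc |Φ p| = |Φ ((1 : ℝ) • p)| := by rw [one_smul]
    _ ≤ K₂ * ‖p‖ ^ 2 / 2 := h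
    _ = K₂ / 2 * ‖p‖ ^ 2 := by ring

/-- **THE SUBTRACTED KERNEL LETTER, SHARP** [folklore]: `U` open, `Φ : E → ℝ`, `Φ ∈ C⁴(U)` even with `Φ 0 = 0`, the segment
`{t•p : t ∈ [0,1]} ⊆ U` and `|D⁴Φ(t•p)[p,p,p,p]| ≤ K₄‖p‖⁴` for `t ∈ (0,1)` ⟹ `|Φ p − ½·D²Φ(0)[p,p]| ≤ (K₄∕24)‖p‖⁴` — the Lagrange
constant `1∕4!`, attained by `t ↦ t⁴` (§7). -/
theorem abs_sub_half_hessian_le_of_fourth_diag_le {Φ : E → ℝ} {U : Set E} (hU : IsOpen U) (hΦ : ContDiffOn ℝ 4 Φ U)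
    (heven : ∀ q, Φ (-q) = Φ q) (h0 : Φ 0 = 0) {p : E} (hseg : ∀ t ∈ Icc (0 : ℝ) 1, t • p ∈ U) {K₄ : ℝ}
    (hK : ∀ t ∈ Ioo (0 : ℝ) 1, |iteratedFDeriv ℝ 4 Φ (t • p) fun _ => p| ≤ K₄ * ‖p‖ ^ 4) :
    |Φ p - iteratedFDeriv ℝ 2 Φ 0 (fun _ => p) / 2| ≤ K₄ / 24 * ‖p‖ ^ 4 := by
  have h0U : (0 : ℝ) • p ∈ U := hseg 0 (left_mem_Icc.2 zero_le_one)
  have h := abs_sub_half_iteratedDeriv_two_le_of_even (g := fun s : ℝ => Φ (s • p)) (M₄ := K₄ * ‖p‖ ^ 4)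
    (fun t ht => contDiffAt_ray_of_contDiffOn hU hΦ p (hseg t ht)) (fun t => by simp [neg_smul, heven])
    (by simpa using h0) fun t ht => by
      rw [iteratedDeriv_ray_of_contDiffOn hU hΦ le_rfl p (hseg t (Ioo_subset_Icc_self ht))]; exact hK t ht
  rw [iteratedDeriv_ray_of_contDiffOn hU hΦ (by norm_num) p h0U, zero_smul, one_smul] at h
  calc _ ≤ K₄ * ‖p‖ ^ 4 / 24 := h
    _ = K₄ / 24 * ‖p‖ ^ 4 := by ring

/-! ## §6 On the ball: the ENDs in the input shape of IHPC §5–§6 -/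

/-- **THE MARGINAL VALUE LETTER ON THE BALL** [folklore]: `U` open ⊇ `closedBall 0 ρ`, `Φ ∈ C²(U)` even, `Φ 0 = 0`, the diagonal
letter `|D²Φ(q)[v,v]| ≤ K₂‖v‖²` on the closed ball ⟹ `∀ p, ‖p‖ ≤ ρ → |Φ p| ≤ (K₂∕2)‖p‖²` — the `hΦ` of IHPC §5
`norm_rescaled_le_of_sq` ∕ `sum_norm_rescaled_le_of_sq` with `C = K₂∕2`. -/
theorem abs_le_on_closedBall {Φ : E → ℝ} {U : Set E} (hU : IsOpen U) {ρ : ℝ} (hρU : Metric.closedBall (0 : E) ρ ⊆ U)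
    (hΦ : ContDiffOn ℝ 2 Φ U) (heven : ∀ q, Φ (-q) = Φ q) (h0 : Φ 0 = 0) {K₂ : ℝ}
    (hK : ∀ q ∈ Metric.closedBall (0 : E) ρ, ∀ v : E, |iteratedFDeriv ℝ 2 Φ q fun _ => v| ≤ K₂ * ‖v‖ ^ 2) :
    ∀ p : E, ‖p‖ ≤ ρ → |Φ p| ≤ K₂ / 2 * ‖p‖ ^ 2 := fun _ hp =>
  abs_le_of_hessian_diag_le hU hΦ heven h0 (fun _ ht => smul_mem_of_closedBall_subset hρU hp ht) fun _ ht =>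
    hK _ (smul_mem_of_closedBall_subset subset_rfl hp (Ioo_subset_Icc_self ht)) _

/-- **THE SUBTRACTED VALUE LETTER ON THE BALL — THE END** [folklore]: `U` open ⊇ `closedBall 0 ρ`, `Φ ∈ C⁴(U)` even, `Φ 0 = 0`,
the diagonal letter `|D⁴Φ(q)[v,v,v,v]| ≤ K₄‖v‖⁴` on the closed ball ⟹ `∀ p, ‖p‖ ≤ ρ → |Φ p − ½·D²Φ(0)[p,p]| ≤ (K₄∕24)‖p‖⁴` —
VERBATIM the shape of the `hR` of IHPC §6 `floor_uniform_of_running_coefficient` (`R q = Φ q − ½·D²Φ(0)[q,q]`, `C = K₄∕24`). -/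
theorem abs_sub_half_hessian_le_on_closedBall {Φ : E → ℝ} {U : Set E} (hU : IsOpen U) {ρ : ℝ}
    (hρU : Metric.closedBall (0 : E) ρ ⊆ U) (hΦ : ContDiffOn ℝ 4 Φ U) (heven : ∀ q, Φ (-q) = Φ q) (h0 : Φ 0 = 0) {K₄ : ℝ}
    (hK : ∀ q ∈ Metric.closedBall (0 : E) ρ, ∀ v : E, |iteratedFDeriv ℝ 4 Φ q fun _ => v| ≤ K₄ * ‖v‖ ^ 4) :
    ∀ p : E, ‖p‖ ≤ ρ → |Φ p - iteratedFDeriv ℝ 2 Φ 0 (fun _ => p) / 2| ≤ K₄ / 24 * ‖p‖ ^ 4 := fun _ hp =>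
  abs_sub_half_hessian_le_of_fourth_diag_le hU hΦ heven h0 (fun _ ht => smul_mem_of_closedBall_subset hρU hp ht) fun _ ht =>
    hK _ (smul_mem_of_closedBall_subset subset_rfl hp (Ioo_subset_Icc_self ht)) _

/-- The operator-norm letter (IHPC's currency) implies the diagonal one: `‖DⁿΦ q‖ ≤ K` ⟹ `|DⁿΦ(q)[v,…,v]| ≤ K‖v‖ⁿ`. -/
theorem abs_diag_le_of_opNorm_le {Φ : E → ℝ} {n : ℕ} {q : E} {K : ℝ} (hK : ‖iteratedFDeriv ℝ n Φ q‖ ≤ K) (v : E) :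
    |iteratedFDeriv ℝ n Φ q fun _ => v| ≤ K * ‖v‖ ^ n := by
  rw [← Real.norm_eq_abs]
  calc ‖iteratedFDeriv ℝ n Φ q fun _ => v‖ ≤ ‖iteratedFDeriv ℝ n Φ q‖ * ∏ _i : Fin n, ‖v‖ :=
        ContinuousMultilinearMap.le_opNorm _ _
    _ ≤ K * ‖v‖ ^ n := by
        rw [Finset.prod_const, Finset.card_univ, Fintype.card_fin]
        exact mul_le_mul_of_nonneg_right hK (by positivity)

/-- IHPC §4's marginal letter with `Φ ∈ C²(U)` ONLY and the Lagrange constant: `‖D²Φ q‖ ≤ K₂` on the closed ball ⟹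
`|Φ p| ≤ (K₂∕2)‖p‖²` for `‖p‖ ≤ ρ`. -/
theorem abs_le_on_closedBall_of_opNorm {Φ : E → ℝ} {U : Set E} (hU : IsOpen U) {ρ : ℝ}
    (hρU : Metric.closedBall (0 : E) ρ ⊆ U) (hΦ : ContDiffOn ℝ 2 Φ U) (heven : ∀ q, Φ (-q) = Φ q) (h0 : Φ 0 = 0) {K₂ : ℝ}
    (hK : ∀ q ∈ Metric.closedBall (0 : E) ρ, ‖iteratedFDeriv ℝ 2 Φ q‖ ≤ K₂) :
    ∀ p : E, ‖p‖ ≤ ρ → |Φ p| ≤ K₂ / 2 * ‖p‖ ^ 2 :=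
  abs_le_on_closedBall hU hρU hΦ heven h0 fun q hq v => abs_diag_le_of_opNorm_le (hK q hq) v

/-- IHPC §4's subtracted letter with `Φ ∈ C⁴(U)` ONLY and the Lagrange constant: `‖D⁴Φ q‖ ≤ K₄` on the closed ball ⟹
`|Φ p − ½·D²Φ(0)[p,p]| ≤ (K₄∕24)‖p‖⁴` for `‖p‖ ≤ ρ`. -/
theorem abs_sub_half_hessian_le_on_closedBall_of_opNorm {Φ : E → ℝ} {U : Set E} (hU : IsOpen U) {ρ : ℝ}
    (hρU : Metric.closedBall (0 : E) ρ ⊆ U) (hΦ : ContDiffOn ℝ 4 Φ U) (heven : ∀ q, Φ (-q) = Φ q) (h0 : Φ 0 = 0) {K₄ : ℝ}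
    (hK : ∀ q ∈ Metric.closedBall (0 : E) ρ, ‖iteratedFDeriv ℝ 4 Φ q‖ ≤ K₄) :
    ∀ p : E, ‖p‖ ≤ ρ → |Φ p - iteratedFDeriv ℝ 2 Φ 0 (fun _ => p) / 2| ≤ K₄ / 24 * ‖p‖ ^ 4 :=
  abs_sub_half_hessian_le_on_closedBall hU hρU hΦ heven h0 fun q hq v => abs_diag_le_of_opNorm_le (hK q hq) v

/-! ## §7 Toys (kernel): the Lagrange constants are attained -/

/-- `g t = t⁴`: even, `g 0 = 0`, `g⁗ ≡ 24`, `g″(0) = 0`, and `|g 1 − 0| = 1 = 24∕24` — the constant `K₄∕24` of §2 is SHARP. -/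
example : |(1 : ℝ) ^ 4 - iteratedDeriv 2 (fun t : ℝ => t ^ 4) 0 / 2| ≤ 24 / 24 :=
  abs_sub_half_iteratedDeriv_two_le_of_even (g := fun t : ℝ => t ^ 4) (M₄ := 24) (fun _ _ => by fun_prop)
    (fun t => by ring) (by norm_num) fun t _ => by simp [Nat.descFactorial]

/-- `g t = t²`: `g″ ≡ 2` and `|g 1| = 1 = 2∕2` — the constant `K₂∕2` of §2 is SHARP. -/
example : |(1 : ℝ) ^ 2| ≤ 2 / 2 :=
  abs_le_half_of_even (g := fun t : ℝ => t ^ 2) (M₂ := 2) (fun _ _ => by fun_prop) (fun t => by ring) (by norm_num)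
    fun t _ => by simp [Nat.descFactorial]

end Summit.QuantumFields.BalabanUV.T4Continuum.NE7b.InheritedHessianPowerCountingLocal

end
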